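import Summits.Ventures.PercRepro.Examples

/-!
# Decidable connectivity on finite data

On a finite multigraph with decidable vertex equality, open adjacency and open-cluster
connectivity are decidable — `instDecidableRelOpenAdj`, `instDecidableRelConn` (through
`conn_iff_reachable` and Mathlib's decidable `SimpleGraph.Reachable` on a finite vertex type) —
hence so is membership in the connection / separation events and in the pattern and partition
events of marked vertices (`instDecidablePredConnEvent`, `instDecidablePredSepEvent`,
`instDecidablePredPatternEvent`, `instDecidablePredPartitionEvent`); `connPatternD` is the
computable twin of the classical `connPattern` (`connPatternD_eq`).

Consequently `decide` evaluates connection statements and the engine's partition rows on concrete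
graphs, configurations and vertices: the last section does so on the 4-cycle `cycle4` of
`Examples` (each `decide` takes about a second on the farm).  With `prob_eq_sum_filter` these
instances also turn every probability on a concrete graph into a finite filtered sum.
(The instances were suggested by typer-2, checked snippet 2026-08-22T02:16Z.)
-/

namespace PercRepro

namespace MultiGraph

variable {V E : Type*} (G : MultiGraph V E)

/-- Open adjacency is decidable on finite data. -/
instance instDecidableRelOpenAdj [DecidableEq V] [Fintype E] (ω : Config E) :
    DecidableRel (G.OpenAdj ω) := fun _ _ => by
  unfold OpenAdj
  infer_instance

/-- Adjacency in the open subgraph is decidable. -/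
instance instDecidableRelOpenGraphAdj [DecidableEq V] [Fintype E] (ω : Config E) :
    DecidableRel (G.openGraph ω).Adj := fun a b =>
  decidable_of_iff _ (SimpleGraph.fromRel_adj _ a b).symm

/-- **Connectivity is decidable on finite data** (via Mathlib's decidable `Reachable`):
`decide` evaluates `G.Conn ω u v` for concrete graphs, configurations and vertices. -/
instance instDecidableRelConn [DecidableEq V] [Fintype V] [Fintype E] (ω : Config E) :
    DecidableRel (G.Conn ω) := fun u v =>
  decidable_of_iff _ (G.conn_iff_reachable ω u v).symm

variable [DecidableEq V] [Fintype V] [Fintype E]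

/-- Membership in a connection event is decidable. -/
instance instDecidablePredConnEvent (u v : V) : DecidablePred (· ∈ G.connEvent u v) :=
  fun ω => decidable_of_iff (G.Conn ω u v) Iff.rfl

/-- Membership in a separation event is decidable. -/
instance instDecidablePredSepEvent (u v : V) : DecidablePred (· ∈ G.sepEvent u v) :=
  fun ω => decidable_of_iff (¬ G.Conn ω u v) Iff.rfl

/-- Membership in a pattern event of marked vertices is decidable. -/
instance instDecidablePredPatternEvent {k : ℕ} (m : Fin k → V) (R : Fin k → Fin k → Bool) :
    DecidablePred (· ∈ G.patternEvent m R) :=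
  fun ω => decidable_of_iff (∀ i j, (G.Conn ω (m i) (m j) ↔ R i j = true)) Iff.rfl

/-- Membership in an engine partition row is decidable. -/
instance instDecidablePredPartitionEvent {k : ℕ} (m : Fin k → V) (rgs : Fin k → ℕ) :
    DecidablePred (· ∈ G.partitionEvent m rgs) :=
  fun ω => decidable_of_iff (∀ i j, (G.Conn ω (m i) (m j) ↔ rgs i = rgs j)) Iff.rfl

/-- Computable twin of `connPattern`: the connectivity pattern of the marked vertices, evaluated
with the decidable connectivity instance (so `decide` / `rfl` can compute it). -/
def connPatternD (ω : Config E) {k : ℕ} (m : Fin k → V) : Fin k → Fin k → Bool :=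
  fun i j => decide (G.Conn ω (m i) (m j))

/-- The computable pattern agrees with the classical one. -/
theorem connPatternD_eq (ω : Config E) {k : ℕ} (m : Fin k → V) :
    G.connPatternD ω m = G.connPattern ω m := by
  funext i j
  simp only [connPatternD, connPattern]
  exact decide_eq_decide.2 Iff.rfl

/-- Reading off the computable pattern. -/
theorem connPatternD_apply_iff {ω : Config E} {k : ℕ} {m : Fin k → V} {i j : Fin k} :
    G.connPatternD ω m i j = true ↔ G.Conn ω (m i) (m j) := by
  simp [connPatternD]

end MultiGraph

/-! ### Exact integer twin of the probability -/

/-- The product order on configurations is decidable on finite data (so `decide` can range over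
chains `v ≤ m ≤ u`). -/
instance Config.instDecidableLE {E : Type*} [Fintype E] : DecidableRel (α := Config E) (· ≤ ·) :=
  fun ω ω' => decidable_of_iff (∀ e, ω e = true → ω' e = true) Config.le_iff.symm

section Integer

variable {E : Type*} [Fintype E] [DecidableEq E]

/-- Integer weight of a configuration for edge probabilities `a e / b e`: the product over the edges
of `a e` (open) or `b e - a e` (closed) — the numerator of the weight over the common denominator
`∏ e, b e` (the engine's exact arithmetic, in `ℕ`). -/
def weightNat (a b : E → ℕ) (ω : Config E) : ℕ := ∏ e, if ω e then a e else b e - a e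

/-- Integer probability numerator of a decidable event: the filtered sum of `weightNat`
(computable; `decide` evaluates it on concrete data, the kernel doing the arithmetic in `ℕ`). -/
def probNat (a b : E → ℕ) (A : Set (Config E)) [DecidablePred (· ∈ A)] : ℕ :=
  ∑ ω ∈ Finset.univ.filter (· ∈ A), weightNat a b ω

omit [DecidableEq E] in
/-- The integer weight is the real weight at `a e / b e` times the common denominator. -/
theorem weightNat_cast (a b : E → ℕ) (hab : ∀ e, a e ≤ b e) (hb : ∀ e, 0 < b e) (ω : Config E) :
    ((weightNat a b ω : ℕ) : ℝ) = (∏ e, (b e : ℝ)) * weight (fun e => (a e : ℝ) / b e) ω := by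
  unfold weightNat weight
  rw [← Finset.prod_mul_distrib]
  push_cast
  refine Finset.prod_congr rfl fun e _ => ?_
  have hb' : (b e : ℝ) ≠ 0 := by exact_mod_cast (hb e).ne'
  split_ifs
  · field_simp
  · rw [Nat.cast_sub (hab e)]
    field_simp

/-- **The integer numerator casts to the real probability**: `probNat a b A = (∏ b e) · P_{a/b}(A)`,
so an exact engine value certified by `probNat` is the value of `prob` at the rational weights. -/
theorem probNat_cast (a b : E → ℕ) (hab : ∀ e, a e ≤ b e) (hb : ∀ e, 0 < b e) (A : Set (Config E))
    [DecidablePred (· ∈ A)] :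
    ((probNat a b A : ℕ) : ℝ) = (∏ e, (b e : ℝ)) * prob (fun e => (a e : ℝ) / b e) A := by
  rw [prob_eq_sum_filter, probNat, Finset.mul_sum]
  push_cast
  exact Finset.sum_congr rfl fun ω _ => weightNat_cast a b hab hb ω

end Integer

/-! ### Computation on the 4-cycle -/

namespace Examples

open MultiGraph

/-- All edges open: `0 ↔ 2` on the 4-cycle (by computation). -/
theorem cycle4_conn_all_open : cycle4.Conn (fun _ => true) 0 2 := by decide

/-- Only the edge `0-1` open: `0` and `2` are separated (by computation). -/
theorem cycle4_not_conn_single : ¬ cycle4.Conn ![true, false, false, false] 0 2 := by decide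

/-- Edges `0-1`, `1-2` open: `0 ↔ 2` through `1` (by computation). -/
theorem cycle4_conn_left : cycle4.Conn ![true, true, false, false] 0 2 := by decide

/-- Edges `2-3`, `3-0` open: `0 ↔ 2` through `3` (by computation). -/
theorem cycle4_conn_right : cycle4.Conn ![false, false, true, true] 0 2 := by decide

/-- Engine row `0 0 1 2` (`0 ↔ 1`, `2` and `3` separate) holds for the configuration with only
the edge `0-1` open (by computation). -/
theorem cycle4_mem_partitionEvent_0012 :
    ![true, false, false, false] ∈ cycle4.partitionEvent ![0, 1, 2, 3] ![0, 0, 1, 2] := by decide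

/-- Engine row `0 0 0 0` (all four joined) holds once three edges are open (by computation). -/
theorem cycle4_mem_partitionEvent_0000 :
    ![true, true, true, false] ∈ cycle4.partitionEvent ![0, 1, 2, 3] ![0, 0, 0, 0] := by decide

/-- The computable pattern of the marked pair `(0, 2)` with edges `0-1`, `1-2` open is the full
pattern (by computation). -/
theorem cycle4_connPatternD_left :
    cycle4.connPatternD ![true, true, false, false] ![0, 2] = ![![true, true], ![true, true]] := by
  decide

/-- The exact engine value `P_{1/2}(0 ↔ 2) = 7/16` on the 4-cycle, by kernel computation of the
integer twin: `7` of the `16` equally weighted configurations connect `0` and `2`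
(cf. the symbolic proof `prob_cycle4_conn_num`). -/
theorem probNat_cycle4_conn :
    probNat (fun _ : Fin 4 => 1) (fun _ => 2) (cycle4.connEvent 0 2) = 7 := by
  decide

/-- The symbolic value of `Examples` recovered from the computed integer one through the cast. -/
theorem prob_cycle4_conn_num' : prob (fun _ => (1 / 2 : ℝ)) (cycle4.connEvent 0 2) = 7 / 16 := by
  have h := probNat_cast (fun _ : Fin 4 => 1) (fun _ => 2) (fun _ => by norm_num)
    (fun _ => by norm_num) (cycle4.connEvent 0 2)
  rw [probNat_cycle4_conn] at h
  norm_num at h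
  linarith

/-- Engine self-test, 2-path at `(2/5, 3/7)`: `P(0 ↔ 2) = 6/35`, numerator `6` over `5 · 7`
(by kernel computation; symbolic twin `prob_path2_conn_num`). -/
theorem probNat_path2_conn : probNat ![2, 3] ![5, 7] (path2.connEvent 0 2) = 6 := by decide

/-- Engine self-test, triangle at `(1/2, 1/3, 1/4)`: `P(0 ↔ 1) = 13/24`, numerator `13` over
`2 · 3 · 4` (by kernel computation; symbolic twin `prob_triangle_conn_num`). -/
theorem probNat_triangle_conn : probNat ![1, 1, 1] ![2, 3, 4] (triangle.connEvent 0 1) = 13 := by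
  decide

/-- Engine self-test, triangle at `(1/2, 1/3, 1/4)`: `P(all separate) = 1/4 = 6/24` (by kernel
computation; symbolic twin `prob_triangle_allSep_num`). -/
theorem probNat_triangle_allSep :
    probNat ![1, 1, 1] ![2, 3, 4]
      (triangle.sepEvent 0 1 ∩ triangle.sepEvent 0 2 ∩ triangle.sepEvent 1 2) = 6 := by
  decide

/-- Engine self-test, triangle at `(1/2, 1/3, 1/4)`: `P(all joined) = 7/24` (by kernel
computation; symbolic twin `prob_triangle_allConn_num`). -/
theorem probNat_triangle_allConn :
    probNat ![1, 1, 1] ![2, 3, 4] (triangle.connEvent 0 1 ∩ triangle.connEvent 1 2) = 7 := by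
  decide

/-! ### The planted control H4 fires in the kernel -/

/-- Planted control H4 (`conjectures/KILLED.md`), the joint event `a ↔ b ↔ c` on `C₄` with
`a, b, c = 0, 1, 2` at `p = 1/10`: numerator `118` over `10⁴` (`= 59/5000`), by kernel computation. -/
theorem probNat_cycle4_H4_abc :
    probNat (fun _ : Fin 4 => 1) (fun _ => 10) (cycle4.connEvent 0 1 ∩ cycle4.connEvent 1 2) =
      118 := by
  decide

/-- H4 control: `P(0 ↔ 1) = 1009/10⁴` on `C₄` at `p = 1/10`, by kernel computation. -/
theorem probNat_cycle4_H4_ab :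
    probNat (fun _ : Fin 4 => 1) (fun _ => 10) (cycle4.connEvent 0 1) = 1009 := by
  decide

/-- H4 control: `P(1 ↔ 2) = 1009/10⁴` on `C₄` at `p = 1/10`, by kernel computation. -/
theorem probNat_cycle4_H4_bc :
    probNat (fun _ : Fin 4 => 1) (fun _ => 10) (cycle4.connEvent 1 2) = 1009 := by
  decide

/-- H4 control: `P(0 ↔ 2) = 199/10⁴` on `C₄` at `p = 1/10`, by kernel computation. -/
theorem probNat_cycle4_H4_ac :
    probNat (fun _ : Fin 4 => 1) (fun _ => 10) (cycle4.connEvent 0 2) = 199 := by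
  decide

/-- **The planted control fires in Lean**: the false hypothesis H4
`P(a ↔ b ↔ c)² ≥ P(a ↔ b) · P(b ↔ c) · P(a ↔ c)` is refuted on `C₄` at `p = 1/10`
(`118² · 10⁴ = 139 240 000 < 202 598 119 = 1009² · 199`; defect `−63358119 / 10¹²`), the four
probabilities being the kernel-computed values above cast to `ℝ` through `probNat_cast`. -/
theorem H4_false_on_cycle4 :
    ¬ (prob (fun _ => (1 / 10 : ℝ)) (cycle4.connEvent 0 1 ∩ cycle4.connEvent 1 2)) ^ 2 ≥
        prob (fun _ => (1 / 10 : ℝ)) (cycle4.connEvent 0 1) *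
          prob (fun _ => (1 / 10 : ℝ)) (cycle4.connEvent 1 2) *
          prob (fun _ => (1 / 10 : ℝ)) (cycle4.connEvent 0 2) := by
  have hab : ∀ _ : Fin 4, (1 : ℕ) ≤ 10 := fun _ => by norm_num
  have hb : ∀ _ : Fin 4, (0 : ℕ) < 10 := fun _ => by norm_num
  have h1 := probNat_cast (fun _ : Fin 4 => 1) (fun _ => 10) hab hb
    (cycle4.connEvent 0 1 ∩ cycle4.connEvent 1 2)
  have h2 := probNat_cast (fun _ : Fin 4 => 1) (fun _ => 10) hab hb (cycle4.connEvent 0 1)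
  have h3 := probNat_cast (fun _ : Fin 4 => 1) (fun _ => 10) hab hb (cycle4.connEvent 1 2)
  have h4 := probNat_cast (fun _ : Fin 4 => 1) (fun _ => 10) hab hb (cycle4.connEvent 0 2)
  rw [probNat_cycle4_H4_abc] at h1
  rw [probNat_cycle4_H4_ab] at h2
  rw [probNat_cycle4_H4_bc] at h3
  rw [probNat_cycle4_H4_ac] at h4
  norm_num at h1 h2 h3 h4
  have e1 : prob (fun _ => (1 / 10 : ℝ)) (cycle4.connEvent 0 1 ∩ cycle4.connEvent 1 2) =
      118 / 10000 := by linarith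
  have e2 : prob (fun _ => (1 / 10 : ℝ)) (cycle4.connEvent 0 1) = 1009 / 10000 := by linarith
  have e3 : prob (fun _ => (1 / 10 : ℝ)) (cycle4.connEvent 1 2) = 1009 / 10000 := by linarith
  have e4 : prob (fun _ => (1 / 10 : ℝ)) (cycle4.connEvent 0 2) = 199 / 10000 := by linarith
  rw [e1, e2, e3, e4]
  norm_num

/-! ### A C-005 instance in the kernel: the five engine rows of the all-marked 4-cycle -/

/-- Engine row `0000` (all four joined) on `C₄` at `p = 1/2`: numerator `5` of `16`. -/
theorem probNat_cycle4_row0000 :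
    probNat (fun _ : Fin 4 => 1) (fun _ => 2) (cycle4.partitionEvent ![0, 1, 2, 3] ![0, 0, 0, 0]) = 5 := by
  decide

/-- Engine row `0123` (all separate) on `C₄` at `p = 1/2`: numerator `1` of `16`. -/
theorem probNat_cycle4_row0123 :
    probNat (fun _ : Fin 4 => 1) (fun _ => 2) (cycle4.partitionEvent ![0, 1, 2, 3] ![0, 1, 2, 3]) = 1 := by
  decide

/-- Engine row `0011` (`ab|cd`) on `C₄` at `p = 1/2`: numerator `1` of `16`. -/
theorem probNat_cycle4_row0011 :
    probNat (fun _ : Fin 4 => 1) (fun _ => 2) (cycle4.partitionEvent ![0, 1, 2, 3] ![0, 0, 1, 1]) = 1 := by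
  decide

/-- Engine row `0101` (`ac|bd`, the non-adjacent crossing) on `C₄` at `p = 1/2`: numerator `0`. -/
theorem probNat_cycle4_row0101 :
    probNat (fun _ : Fin 4 => 1) (fun _ => 2) (cycle4.partitionEvent ![0, 1, 2, 3] ![0, 1, 0, 1]) = 0 := by
  decide

/-- Engine row `0110` (`ad|bc`) on `C₄` at `p = 1/2`: numerator `1` of `16`. -/
theorem probNat_cycle4_row0110 :
    probNat (fun _ : Fin 4 => 1) (fun _ => 2) (cycle4.partitionEvent ![0, 1, 2, 3] ![0, 1, 1, 0]) = 1 := by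
  decide

/-- **A C-005 instance checked in the kernel**: on the all-marked 4-cycle at `p = 1/2`,
`top · bot = 5/256 ≥ 1/256 = x₁x₂ + x₁x₃ + x₂x₃` (the rows being the kernel-computed numerators
above, cast through `probNat_cast`). -/
theorem C005_instance_cycle4_half :
    prob (fun _ => (1 / 2 : ℝ)) (cycle4.partitionEvent ![0, 1, 2, 3] ![0, 0, 1, 1]) *
        prob (fun _ => (1 / 2 : ℝ)) (cycle4.partitionEvent ![0, 1, 2, 3] ![0, 1, 0, 1]) +
      prob (fun _ => (1 / 2 : ℝ)) (cycle4.partitionEvent ![0, 1, 2, 3] ![0, 0, 1, 1]) *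
        prob (fun _ => (1 / 2 : ℝ)) (cycle4.partitionEvent ![0, 1, 2, 3] ![0, 1, 1, 0]) +
      prob (fun _ => (1 / 2 : ℝ)) (cycle4.partitionEvent ![0, 1, 2, 3] ![0, 1, 0, 1]) *
        prob (fun _ => (1 / 2 : ℝ)) (cycle4.partitionEvent ![0, 1, 2, 3] ![0, 1, 1, 0]) ≤
    prob (fun _ => (1 / 2 : ℝ)) (cycle4.partitionEvent ![0, 1, 2, 3] ![0, 0, 0, 0]) *
      prob (fun _ => (1 / 2 : ℝ)) (cycle4.partitionEvent ![0, 1, 2, 3] ![0, 1, 2, 3]) := by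
  have hab : ∀ _ : Fin 4, (1 : ℕ) ≤ 2 := fun _ => by norm_num
  have hb : ∀ _ : Fin 4, (0 : ℕ) < 2 := fun _ => by norm_num
  have key : ∀ (rgs : Fin 4 → ℕ) (n : ℕ),
      probNat (fun _ : Fin 4 => 1) (fun _ => 2) (cycle4.partitionEvent ![0, 1, 2, 3] rgs) = n →
      prob (fun _ => (1 / 2 : ℝ)) (cycle4.partitionEvent ![0, 1, 2, 3] rgs) = n / 16 := by
    intro rgs n hn
    have h := probNat_cast (fun _ : Fin 4 => 1) (fun _ => 2) hab hb
      (cycle4.partitionEvent ![0, 1, 2, 3] rgs)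
    rw [hn] at h
    norm_num at h
    linarith
  rw [key _ _ probNat_cycle4_row0000, key _ _ probNat_cycle4_row0123, key _ _ probNat_cycle4_row0011,
    key _ _ probNat_cycle4_row0101, key _ _ probNat_cycle4_row0110]
  norm_num

/-! ### A complete engine law line in the kernel: the triangle at `(1/2, 1/3, 1/4)`, `k = 3` -/

/-- Triangle row `000` (`abc`) at `(1/2, 1/3, 1/4)`: numerator `7` of `24`. -/
theorem probNat_triangle_row000 :
    probNat ![1, 1, 1] ![2, 3, 4] (triangle.partitionEvent ![0, 1, 2] ![0, 0, 0]) = 7 := by decide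

/-- Triangle row `001` (`ab|c`): numerator `6` of `24`. -/
theorem probNat_triangle_row001 :
    probNat ![1, 1, 1] ![2, 3, 4] (triangle.partitionEvent ![0, 1, 2] ![0, 0, 1]) = 6 := by decide

/-- Triangle row `010` (`ac|b`): numerator `3` of `24`. -/
theorem probNat_triangle_row010 :
    probNat ![1, 1, 1] ![2, 3, 4] (triangle.partitionEvent ![0, 1, 2] ![0, 1, 0]) = 3 := by decide

/-- Triangle row `011` (`bc|a`): numerator `2` of `24`. -/
theorem probNat_triangle_row011 :
    probNat ![1, 1, 1] ![2, 3, 4] (triangle.partitionEvent ![0, 1, 2] ![0, 1, 1]) = 2 := by decide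

/-- Triangle row `012` (`a|b|c`): numerator `6` of `24`. -/
theorem probNat_triangle_row012 :
    probNat ![1, 1, 1] ![2, 3, 4] (triangle.partitionEvent ![0, 1, 2] ![0, 1, 2]) = 6 := by decide

/-- The five kernel-computed rows sum to the denominator `24 = 2 · 3 · 4`: the law line is
complete (`7 + 6 + 3 + 2 + 6 = 24`). -/
theorem probNat_triangle_rows_sum :
    probNat ![1, 1, 1] ![2, 3, 4] (triangle.partitionEvent ![0, 1, 2] ![0, 0, 0]) +
      probNat ![1, 1, 1] ![2, 3, 4] (triangle.partitionEvent ![0, 1, 2] ![0, 0, 1]) +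
      probNat ![1, 1, 1] ![2, 3, 4] (triangle.partitionEvent ![0, 1, 2] ![0, 1, 0]) +
      probNat ![1, 1, 1] ![2, 3, 4] (triangle.partitionEvent ![0, 1, 2] ![0, 1, 1]) +
      probNat ![1, 1, 1] ![2, 3, 4] (triangle.partitionEvent ![0, 1, 2] ![0, 1, 2]) = 24 := by
  rw [probNat_triangle_row000, probNat_triangle_row001, probNat_triangle_row010,
    probNat_triangle_row011, probNat_triangle_row012]

end Examples

end PercRepro
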